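import Literature.NumberTheory.Rogawski1990.KottwitzSignArchCongruence        -- ★ (T-d) FILE 3 (F0P3a-p02 (g10)): the frame `(T Φ hΦ hT)`, `map_evalC_coe_archCongr`, `map_evalC_formCongr`; brings ★ FILE 1∕2
import Literature.NumberTheory.Rogawski1990.ArchDeltaTransferCongruence        -- ★ (T-d) FILE 5 (F0P3a-p02 (g10)): `isArchNormPair_archCongr_iff`
import Literature.NumberTheory.Automorphic.ArchCongruenceOrbitalTransport        -- ★ (T-d) FILE 1 (F0P3a-p02 (g10)): `coe_archCongrOfEq_apply`, `formCongr_map_mixedEmbedding_archFormOf_eq` (the tree's term `Φ_P`)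
import Literature.NumberTheory.Rogawski1990.ArchExplicitTransferFactorConjRight -- ★ B-p12 (g25): `archEigenlineProjector_eq_vecMulVec_of_isArchNormPair` (rank ≤ 1 on norm pairs), `archExplicitDelta_conj_right`
import HarnessLib

/-!
# Rogawski's explicit archimedean transfer factor is CONGRUENCE-COVARIANT: `Δ″_∞^{H}(γ_H, Φ g) = Δ″_∞^{H₂}(γ_H, g)` along `Φ : U(H₂)(L ⊗ ℝ) ≃ₜ* U(H)(L ⊗ ℝ)`, `g ↦ T g T⁻¹`,
# `(c⊗1)(T)ᵀ (H⊗1) T = H₂⊗1` (ROAD-Sd (T-d) for `Δ″_∞`; Rogawski 1990 §14.4 p. 237 «`Δ″_v = Δ_v ∘ ψ_v`», §14.6 p. 242; Langlands–Shelstad 1987 §2)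

Topic `NumberTheory/Rogawski1990`; namespace `Literature.NumberTheory.Rogawski1990`.  THEOREMS ONLY (no `def`, no instance, no notation, no axiom, no named fact, no `sorry`).
Cell `pub/hodgecm-mathlib`, ENGINE T1 (crux H413 = `stmt-HodgeConjecture-24833`); floor-1½ preparation, count-neutral, under row (S-c) ∕ `stub_ScCore` of the «SdArch» pay-down line:
brick **(3T-b) = skeleton v0 `Node3T`** of the 3Z assembly (pen F0P3a-p03 (g11); LEAD F0P3a-plan (g9) WORDS T8-96∕T8-97, 2026-09-01; author F0P3a-p05 (g12)).  Sequel of ★ (T-d) FILES 3∕5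
(frame `(T Φ hΦ hT)` VERBATIM) and of ★ B-p12 `ArchExplicitTransferFactorConjRight` (the case `H₂ = H`, `T ∈ U(H)`).

THE MATHEMATICS.  `Δ″_∞(γ_H, γ′) = τ(γ_H) · D_{G∕H,∞}(γ_H) · Π_w κ_w(γ_H, γ′)` on norm pairs, `0` off them (★ `archExplicitDelta`); `τ`, `D` see only `γ_H`; norm pairs are carried by `Φ`
(★ FILE 5 `isArchNormPair_archCongr_iff`: `ι(γ_H)` is `GL₃(L ⊗ ℝ)`-conjugate to `T g T⁻¹` iff to `g`).  The sign `κ_w(γ_H, γ′) = sgn Re tr(P_wᴴ · H_w · P_w) · η_w(H)`, `P_w = χ_{g_w}(γ′_w)`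
(★ `archEigenlineProjector`), `η_w` = ★ `archMajoritySign`: (i) `P_w(γ_H, Φ g) = T_w · P_w(γ_H, g) · T_w⁻¹` (a polynomial in `γ′_w`; `(Φ g)_w = T_w g_w T_w⁻¹`, ★ FILE 3 `map_evalC_coe_archCongr`);
(ii) `(H₂)_w = T_wᴴ · H_w · T_w` (★ FILE 3 `map_evalC_formCongr` + ★ `archFormOf_map_evalC`), so `tr(P′ᴴ H_w P′) = tr((P T_w⁻¹)ᴴ · (H₂)_w · (P T_w⁻¹))` and ON A NORM PAIR `P` HAS RANK ≤ 1
(★ `archEigenlineProjector_eq_vecMulVec_of_isArchNormPair`), where the sign of `Re tr((P A)ᴴ M (P A)) = |s|²‖qA‖² Re(pᴴ M p)` does not see the invertible `A` (§1, B-p12's private §1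
re-derived); (iii) `η_w(H) = η_w(H₂)`: a 2-plane `⟨u, v⟩` on which `(H₂)_w` is positive gives the 2-plane `⟨T_w u, T_w v⟩` for `H_w`, and back with `T_w⁻¹`.  Hence
`κ_w(γ_H, Φ g) = κ_w(γ_H, g)` on norm pairs and **`Δ″_∞^{H}(γ_H, Φ g) = Δ″_∞^{H₂}(γ_H, g)`** for all `g` — print's «`Δ″_v(γ_H, γ′) = Δ_v(γ_H, ψ_v(γ′))`» read for a congruence of
hermitian forms over `L` (the 3Z assembly moves `stub_ScCore`'s `H′` to the rational diagonal frame `c(P)ᵀ H′ P = diag α′`, ★ `exists_formCongr_eq_diagonal`, where ★ (3G)∕(3G♭) read).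
* §1 private rank-one ∕ conjugation algebra over `ℂ`.
* §2 `archEigenlineProjector_archCongr`; `map_embedding_eq_conjTranspose_mul_mul_of_formCongr` (`(H₂)_w = T_wᴴ H_w T_w`); **`archMajoritySign_archCongr`** (`η_w(H) = η_w(H₂)`; positive 2-planes under `M ↦ Sᴴ M S`, private).
* §3 **`archKappaAt_archCongr`** (norm pairs); §4 **`archExplicitDelta_archCongr`** (all `g`) = `Node3T`; `archExplicitDelta_archCongrOfEq` (the tree's term for `h : c(P)ᵀ H P = H₂`).
HONEST LABEL: HC_CM is proved only modulo the printed citations until rung 0 closes; this file is linear algebra over Mathlib + ★ cell files and pays nothing by itself.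

## References
* [Rogawski1990] J. D. Rogawski, *Automorphic Representations of Unitary Groups in Three Variables*, Ann. of Math. Stud. 123 (1990), §14.4 p. 237 («`Δ″_v = Δ_v ∘ ψ_v`»), §14.6 p. 242
  (`Δ″_v`, `κ = ±1`, the constants `c_v`), §4.9 p. 55 (`τ`, `D_{G∕H}`), §14.1 p. 232 (the forms `Φ`, `H′`).
* [LanglandsShelstad1987] R. P. Langlands, D. Shelstad, *On the definition of transfer factors*, Math. Ann. 278 (1987), §1–§2 (transfer factors as functions of matching pairs; relative position).
* [PlatonovRapinchuk1994] V. Platonov, A. Rapinchuk, *Algebraic Groups and Number Theory* (1994), §2.3 (congruent hermitian forms have conjugate unitary groups).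
-/

set_option autoImplicit false

noncomputable section

open NumberField NumberField.InfinitePlace NumberField.mixedEmbedding Matrix
open scoped Matrix MatrixGroups ComplexOrder

namespace Literature.NumberTheory.Rogawski1990

open Literature.NumberTheory.Automorphic
open Literature.NumberTheory.GaloisRepresentations

/-! ## §1 Rank-one and conjugation algebra over `ℂ` (B-p12's private §1 of ★ `ArchExplicitTransferFactorConjRight`, re-derived) -/

section Algebra

variable {n : Type*} [Fintype n]

/-- `r̄ · r = Σ_i |r_i|²` (as a real number). [folklore] -/
private theorem star_dotProduct_self_eq_ofReal' (r : n → ℂ) :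
    star r ⬝ᵥ r = ((∑ i, Complex.normSq (r i) : ℝ) : ℂ) := by
  rw [Complex.ofReal_sum]
  simp only [dotProduct, Pi.star_apply, Complex.star_def, Complex.normSq_eq_conj_mul_self]

/-- For `P = s · p qᵀ`: `Re tr((P A)ᴴ M (P A)) = |s|² · ‖qA‖² · Re(pᴴ M p)`. [folklore] -/
private theorem re_trace_conjTranspose_mul_mul_rankOne_mul' (s : ℂ) (p q : n → ℂ) (M A : Matrix n n ℂ) :
    ((s • vecMulVec p q * A)ᴴ * M * (s • vecMulVec p q * A)).trace.re =
      Complex.normSq s * (∑ i, Complex.normSq ((q ᵥ* A) i)) * (star p ⬝ᵥ M *ᵥ p).re := by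
  have h : ((s • vecMulVec p q * A)ᴴ * M * (s • vecMulVec p q * A)).trace =
      (starRingEnd ℂ s * s) * (star (q ᵥ* A) ⬝ᵥ (q ᵥ* A)) * (star p ⬝ᵥ M *ᵥ p) := by
    rw [Matrix.smul_mul, vecMulVec_mul, conjTranspose_smul, conjTranspose_vecMulVec, Matrix.smul_mul, Matrix.smul_mul,
      Matrix.mul_smul, smul_smul, trace_smul, vecMulVec_mul, vecMulVec_mul_vecMulVec, trace_vecMulVec, dotProduct_smul,
      ← dotProduct_mulVec, smul_eq_mul, smul_eq_mul, Complex.star_def]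
    ring
  rw [h, star_dotProduct_self_eq_ofReal', ← Complex.normSq_eq_conj_mul_self, ← Complex.ofReal_mul, Complex.re_ofReal_mul]

/-- **`sgn Re tr((PA)ᴴ M (PA)) = sgn Re tr(Pᴴ M P)` for `P = s · p qᵀ` of rank `≤ 1` and `A` (right-)invertible.** [folklore] -/
private theorem sign_re_trace_rankOne_mul_eq' [DecidableEq n] (s : ℂ) (p q : n → ℂ) (M A B : Matrix n n ℂ) (hAB : A * B = 1) :
    SignType.sign ((s • vecMulVec p q * A)ᴴ * M * (s • vecMulVec p q * A)).trace.re =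
      SignType.sign ((s • vecMulVec p q)ᴴ * M * (s • vecMulVec p q)).trace.re := by
  conv_rhs => rw [← Matrix.mul_one (s • vecMulVec p q)]
  rw [re_trace_conjTranspose_mul_mul_rankOne_mul', re_trace_conjTranspose_mul_mul_rankOne_mul', vecMul_one, sign_mul, sign_mul,
    sign_mul, sign_mul]
  congr 2
  have key : ∀ r : n → ℂ, (∑ i, Complex.normSq (r i)) = 0 ↔ r = 0 := by
    intro r
    rw [← Complex.ofReal_eq_zero, ← star_dotProduct_self_eq_ofReal', dotProduct_star_self_eq_zero]
  have hiff : (∑ i, Complex.normSq ((q ᵥ* A) i)) = 0 ↔ (∑ i, Complex.normSq (q i)) = 0 := by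
    rw [key, key]
    constructor
    · intro h
      have : q ᵥ* (A * B) = 0 := by rw [← vecMul_vecMul, h, zero_vecMul]
      rwa [hAB, vecMul_one] at this
    · intro h
      rw [h, zero_vecMul]
  have hu : 0 ≤ ∑ i, Complex.normSq ((q ᵥ* A) i) := Finset.sum_nonneg fun i _ => Complex.normSq_nonneg _
  have hv : 0 ≤ ∑ i, Complex.normSq (q i) := Finset.sum_nonneg fun i _ => Complex.normSq_nonneg _
  rcases hu.eq_or_lt with hu0 | hu0
  · rw [← hu0, hiff.1 hu0.symm, sign_zero]
  · have hv0 : 0 < ∑ i, Complex.normSq (q i) := lt_of_le_of_ne hv (fun h0 => (hu0.ne' (hiff.2 h0.symm)))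
    rw [sign_pos hu0, sign_pos hv0]

/-- `(c X c′)² − t·(c X c′) + d·1 = c · (X² − t·X + d·1) · c′` for `c′ c = 1 = c c′`. [folklore] -/
private theorem conj_mul_sq_sub_smul_add_smul_one' {m : Type*} [Fintype m] [DecidableEq m] (c c' X : Matrix m m ℂ) (t d : ℂ)
    (h1 : c' * c = 1) (h2 : c * c' = 1) :
    c * X * c' * (c * X * c') - t • (c * X * c') + d • (1 : Matrix m m ℂ) = c * (X * X - t • X + d • (1 : Matrix m m ℂ)) * c' := by
  have hsq : c * X * c' * (c * X * c') = c * (X * X) * c' := by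
    calc c * X * c' * (c * X * c') = c * X * (c' * c) * X * c' := by simp only [Matrix.mul_assoc]
      _ = c * (X * X) * c' := by rw [h1, Matrix.mul_one]; simp only [Matrix.mul_assoc]
  rw [hsq]
  simp only [Matrix.mul_sub, Matrix.mul_add, Matrix.sub_mul, Matrix.add_mul, Matrix.mul_smul, Matrix.smul_mul, Matrix.mul_one, h2]

/-- `(S x)ᴴ · M · (S x) = xᴴ · (Sᴴ M S) · x` as hermitian values. [folklore] -/
private theorem star_mulVec_dotProduct_mulVec (S M : Matrix n n ℂ) (x : n → ℂ) :
    star (S *ᵥ x) ⬝ᵥ M *ᵥ (S *ᵥ x) = star x ⬝ᵥ (Sᴴ * M * S) *ᵥ x := by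
  simp only [star_mulVec, dotProduct_mulVec, vecMul_vecMul, Matrix.mul_assoc]

/-- **POSITIVE 2-PLANES UNDER A CONGRUENCE**: if `Sᴴ M S` is positive on a 2-plane `⟨u, v⟩` and `S′ S = 1`, then `M` is positive on the 2-plane `⟨S u, S v⟩`. [folklore] -/
private theorem exists_pos_plane_of_conjTranspose_mul_mul [DecidableEq n] (S S' M : Matrix n n ℂ) (hS : S' * S = 1)
    (h : ∃ u v : n → ℂ, LinearIndependent ℂ ![u, v] ∧
      ∀ a b : ℂ, (a, b) ≠ (0, 0) → 0 < (star (a • u + b • v) ⬝ᵥ (Sᴴ * M * S) *ᵥ (a • u + b • v)).re) :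
    ∃ u v : n → ℂ, LinearIndependent ℂ ![u, v] ∧ ∀ a b : ℂ, (a, b) ≠ (0, 0) → 0 < (star (a • u + b • v) ⬝ᵥ M *ᵥ (a • u + b • v)).re := by
  obtain ⟨u, v, hli, hpos⟩ := h
  have hinj : ∀ x : n → ℂ, S *ᵥ x = 0 → x = 0 := fun x hx => by
    have : S' *ᵥ (S *ᵥ x) = 0 := by rw [hx, Matrix.mulVec_zero]
    rwa [Matrix.mulVec_mulVec, hS, Matrix.one_mulVec] at this
  have hlin : ∀ a b : ℂ, a • (S *ᵥ u) + b • (S *ᵥ v) = S *ᵥ (a • u + b • v) := fun a b => by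
    rw [Matrix.mulVec_add, Matrix.mulVec_smul, Matrix.mulVec_smul]
  refine ⟨S *ᵥ u, S *ᵥ v, ?_, fun a b hab => ?_⟩
  · rw [LinearIndependent.pair_iff] at hli ⊢
    intro s t hst
    rw [hlin] at hst
    exact hli s t (hinj _ hst)
  · rw [hlin, star_mulVec_dotProduct_mulVec]
    exact hpos a b hab

end Algebra

/-! ## §2 `P_w` and `η_w` under the congruence -/

section Congr

variable (L : Type) [Field L] [NumberField L] [IsCMField L] {H H₂ : Matrix (Fin 3) (Fin 3) L} (T : GL (Fin 3) (mixedSpace L))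
  (Φ : UnitaryGroup.arch (↥(maximalRealSubfield L)) L (IsCMField.complexConj L) 3 H₂ ≃ₜ* UnitaryGroup.arch (↥(maximalRealSubfield L)) L (IsCMField.complexConj L) 3 H)
  (hΦ : ∀ g : UnitaryGroup.arch (↥(maximalRealSubfield L)) L (IsCMField.complexConj L) 3 H₂,
    ((Φ g : UnitaryGroup.arch (↥(maximalRealSubfield L)) L (IsCMField.complexConj L) 3 H) : GL (Fin 3) (mixedSpace L)) = T * (g : GL (Fin 3) (mixedSpace L)) * T⁻¹)
  (hT : formCongr (UnitaryGroup.conjMixed (↥(maximalRealSubfield L)) L (IsCMField.complexConj L)) T (UnitaryGroup.archFormOf L 3 H) = UnitaryGroup.archFormOf L 3 H₂)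
  (γH : ↥(UnitaryGroup.arch (↥(maximalRealSubfield L)) L (IsCMField.complexConj L) 2
      (Matrix.of fun i j : Fin 2 => if i.val + j.val + 1 = 2 then (1 : L) else 0)) ×
    ↥(UnitaryGroup.arch (↥(maximalRealSubfield L)) L (IsCMField.complexConj L) 1
      (Matrix.of fun i j : Fin 1 => if i.val + j.val + 1 = 1 then (1 : L) else 0)))

omit [NumberField L] [IsCMField L] in
/-- `T_w⁻¹ · T_w = 1` (bookkeeping). [folklore] -/
private theorem coe_map_evalC_inv_mul (w : {w : InfinitePlace L // IsComplex w}) :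
    (((Matrix.GeneralLinearGroup.map (UnitaryGroup.evalC L w) T)⁻¹ : GL (Fin 3) ℂ) : Matrix (Fin 3) (Fin 3) ℂ) *
        ((Matrix.GeneralLinearGroup.map (UnitaryGroup.evalC L w) T : GL (Fin 3) ℂ) : Matrix (Fin 3) (Fin 3) ℂ) = 1 := by
  rw [← Units.val_mul, inv_mul_cancel, Units.val_one]

omit [NumberField L] [IsCMField L] in
/-- `T_w · T_w⁻¹ = 1` (bookkeeping). [folklore] -/
private theorem coe_map_evalC_mul_inv (w : {w : InfinitePlace L // IsComplex w}) :
    ((Matrix.GeneralLinearGroup.map (UnitaryGroup.evalC L w) T : GL (Fin 3) ℂ) : Matrix (Fin 3) (Fin 3) ℂ) *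
        (((Matrix.GeneralLinearGroup.map (UnitaryGroup.evalC L w) T)⁻¹ : GL (Fin 3) ℂ) : Matrix (Fin 3) (Fin 3) ℂ) = 1 := by
  rw [← Units.val_mul, mul_inv_cancel, Units.val_one]

include hΦ in
/-- **`P_w(γ_H, Φ g) = T_w · P_w(γ_H, g) · T_w⁻¹`** — `P_w = χ_{g_w}(γ′_w)` is a polynomial in `γ′_w` and `(Φ g)_w = T_w g_w T_w⁻¹` (★ FILE 3 `map_evalC_coe_archCongr`).
[cite: Rogawski1990, §14.6 p. 242; §14.4 p. 237] -/
theorem archEigenlineProjector_archCongr (w : {w : InfinitePlace L // IsComplex w}) (g : UnitaryGroup.arch (↥(maximalRealSubfield L)) L (IsCMField.complexConj L) 3 H₂) :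
    archEigenlineProjector L H γH w (Φ g) =
      ((Matrix.GeneralLinearGroup.map (UnitaryGroup.evalC L w) T : GL (Fin 3) ℂ) : Matrix (Fin 3) (Fin 3) ℂ) * archEigenlineProjector L H₂ γH w g *
        (((Matrix.GeneralLinearGroup.map (UnitaryGroup.evalC L w) T)⁻¹ : GL (Fin 3) ℂ) : Matrix (Fin 3) (Fin 3) ℂ) := by
  dsimp only [archEigenlineProjector]
  rw [map_evalC_coe_archCongr L T Φ hΦ w g]
  exact conj_mul_sq_sub_smul_add_smul_one' _ _ _ _ _ (coe_map_evalC_inv_mul L T w) (coe_map_evalC_mul_inv L T w)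

include hT in
/-- **`(H₂)_w = T_wᴴ · H_w · T_w`** — the `w`-coordinate of `hT` (★ FILE 3 `map_evalC_formCongr`, ★ `archFormOf_map_evalC`, `formCongr_star`). [cite: Rogawski1990, §14.1 p. 232]
[cite: PlatonovRapinchuk1994, §2.3] -/
theorem map_embedding_eq_conjTranspose_mul_mul_of_formCongr (w : {w : InfinitePlace L // IsComplex w}) :
    H₂.map w.1.embedding =
      ((Matrix.GeneralLinearGroup.map (UnitaryGroup.evalC L w) T : GL (Fin 3) ℂ) : Matrix (Fin 3) (Fin 3) ℂ)ᴴ * H.map w.1.embedding *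
        ((Matrix.GeneralLinearGroup.map (UnitaryGroup.evalC L w) T : GL (Fin 3) ℂ) : Matrix (Fin 3) (Fin 3) ℂ) := by
  have e₁ : (UnitaryGroup.archFormOf L 3 H).map (UnitaryGroup.evalC L w) = H.map w.1.embedding := UnitaryGroup.archFormOf_map_evalC L 3 H w
  have e₂ : (UnitaryGroup.archFormOf L 3 H₂).map (UnitaryGroup.evalC L w) = H₂.map w.1.embedding := UnitaryGroup.archFormOf_map_evalC L 3 H₂ w
  rw [← e₂, ← hT, map_evalC_formCongr, formCongr_star, e₁]

include hT in
open scoped Classical in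
/-- **`η_w(H) = η_w(H₂)`**: positivity of the form on some complex 2-plane is a congruence invariant (`(H₂)_w = T_wᴴ H_w T_w`; §1 `exists_pos_plane_of_conjTranspose_mul_mul` with `T_w` and
with `T_w⁻¹`). [cite: Rogawski1990, §14.6 p. 242; §14.2 p. 232] -/
theorem archMajoritySign_archCongr (w : {w : InfinitePlace L // IsComplex w}) : archMajoritySign L H w = archMajoritySign L H₂ w := by
  set Tw : Matrix (Fin 3) (Fin 3) ℂ := ((Matrix.GeneralLinearGroup.map (UnitaryGroup.evalC L w) T : GL (Fin 3) ℂ) : Matrix (Fin 3) (Fin 3) ℂ) with hTw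
  set Tw' : Matrix (Fin 3) (Fin 3) ℂ := (((Matrix.GeneralLinearGroup.map (UnitaryGroup.evalC L w) T)⁻¹ : GL (Fin 3) ℂ) : Matrix (Fin 3) (Fin 3) ℂ) with hTw'
  have h1 : Tw' * Tw = 1 := coe_map_evalC_inv_mul L T w
  have h2 : Tw * Tw' = 1 := coe_map_evalC_mul_inv L T w
  have hH₂ : H₂.map w.1.embedding = Twᴴ * H.map w.1.embedding * Tw := map_embedding_eq_conjTranspose_mul_mul_of_formCongr L T hT w
  have hH : H.map w.1.embedding = Tw'ᴴ * H₂.map w.1.embedding * Tw' := by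
    rw [hH₂]
    calc H.map w.1.embedding = (Tw * Tw')ᴴ * H.map w.1.embedding * (Tw * Tw') := by rw [h2, conjTranspose_one, Matrix.one_mul, Matrix.mul_one]
      _ = Tw'ᴴ * (Twᴴ * H.map w.1.embedding * Tw) * Tw' := by rw [conjTranspose_mul]; simp only [Matrix.mul_assoc]
  have key : (∃ u v : Fin 3 → ℂ, LinearIndependent ℂ ![u, v] ∧
        ∀ a b : ℂ, (a, b) ≠ (0, 0) → 0 < (star (a • u + b • v) ⬝ᵥ (H.map w.1.embedding) *ᵥ (a • u + b • v)).re) ↔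
      (∃ u v : Fin 3 → ℂ, LinearIndependent ℂ ![u, v] ∧
        ∀ a b : ℂ, (a, b) ≠ (0, 0) → 0 < (star (a • u + b • v) ⬝ᵥ (H₂.map w.1.embedding) *ᵥ (a • u + b • v)).re) := by
    constructor
    · intro h
      rw [hH] at h
      exact exists_pos_plane_of_conjTranspose_mul_mul Tw' Tw _ h2 h
    · intro h
      rw [hH₂] at h
      exact exists_pos_plane_of_conjTranspose_mul_mul Tw Tw' _ h1 h
  unfold archMajoritySign
  by_cases hc : ∃ u v : Fin 3 → ℂ, LinearIndependent ℂ ![u, v] ∧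
      ∀ a b : ℂ, (a, b) ≠ (0, 0) → 0 < (star (a • u + b • v) ⬝ᵥ (H.map w.1.embedding) *ᵥ (a • u + b • v)).re
  · rw [if_pos hc, if_pos (key.1 hc)]
  · rw [if_neg hc, if_neg (fun h => hc (key.2 h))]

/-! ## §3 `κ_w` under the congruence -/

include hΦ hT in
/-- **`κ_w(γ_H, Φ g) = κ_w(γ_H, g)` ON NORM PAIRS**: `tr(P′ᴴ H_w P′) = tr((P T_w⁻¹)ᴴ (H₂)_w (P T_w⁻¹))` with `P′ = T_w P T_w⁻¹`, and `P = P_w(γ_H, g)` has rank `≤ 1` on a norm pair (★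
`archEigenlineProjector_eq_vecMulVec_of_isArchNormPair`), so the sign of the trace survives the invertible right factor (§1); the majority signs agree (§2).
[cite: Rogawski1990, §14.6 p. 242; §14.4 p. 237] [cite: LanglandsShelstad1987, §2] -/
theorem archKappaAt_archCongr {g : UnitaryGroup.arch (↥(maximalRealSubfield L)) L (IsCMField.complexConj L) 3 H₂} (h : IsArchNormPair L H₂ γH g)
    (w : {w : InfinitePlace L // IsComplex w}) : archKappaAt L H γH w (Φ g) = archKappaAt L H₂ γH w g := by
  obtain ⟨p, q, hP⟩ := archEigenlineProjector_eq_vecMulVec_of_isArchNormPair L H₂ γH g w h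
  unfold archKappaAt
  rw [archEigenlineProjector_archCongr L T Φ hΦ γH w g, hP, archMajoritySign_archCongr L T hT w]
  set Tw : Matrix (Fin 3) (Fin 3) ℂ := ((Matrix.GeneralLinearGroup.map (UnitaryGroup.evalC L w) T : GL (Fin 3) ℂ) : Matrix (Fin 3) (Fin 3) ℂ) with hTw
  set Tw' : Matrix (Fin 3) (Fin 3) ℂ := (((Matrix.GeneralLinearGroup.map (UnitaryGroup.evalC L w) T)⁻¹ : GL (Fin 3) ℂ) : Matrix (Fin 3) (Fin 3) ℂ) with hTw'
  have h1 : Tw' * Tw = 1 := coe_map_evalC_inv_mul L T w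
  have hH₂ : H₂.map w.1.embedding = Twᴴ * H.map w.1.embedding * Tw := map_embedding_eq_conjTranspose_mul_mul_of_formCongr L T hT w
  have hcong : (Tw * vecMulVec p q * Tw')ᴴ * H.map w.1.embedding * (Tw * vecMulVec p q * Tw') =
      ((1 : ℂ) • vecMulVec p q * Tw')ᴴ * H₂.map w.1.embedding * ((1 : ℂ) • vecMulVec p q * Tw') := by
    rw [one_smul, hH₂, Matrix.mul_assoc Tw, conjTranspose_mul]
    simp only [Matrix.mul_assoc]
  have hone : ((1 : ℂ) • vecMulVec p q)ᴴ * H₂.map w.1.embedding * ((1 : ℂ) • vecMulVec p q) =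
      (vecMulVec p q)ᴴ * H₂.map w.1.embedding * vecMulVec p q := by rw [one_smul]
  rw [hcong, sign_re_trace_rankOne_mul_eq' 1 p q (H₂.map w.1.embedding) Tw' Tw h1, hone]

/-! ## §4 The head: `Δ″_∞` under the congruence -/

include hΦ hT in
open scoped Classical in
/-- **(3T-b) `Node3T`: `Δ″_∞^{H}(γ_H, Φ g) = Δ″_∞^{H₂}(γ_H, g)`** for every `γ_H ∈ H_∞`, `g ∈ U(H₂)(L ⊗ ℝ)` — `τ`, `D_{G∕H,∞}` see only `γ_H`; norm pairs are carried by `Φ` (★ FILE 5); `Π_w κ_w` by §3.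
Print's «`Δ″_v(γ_H, γ′) = Δ_v(γ_H, ψ_v(γ′))`» for a congruence of hermitian forms over `L`. [cite: Rogawski1990, §14.4 p. 237; §14.6 p. 242] [cite: LanglandsShelstad1987, §2] -/
theorem archExplicitDelta_archCongr (μ : HeckeCharacter L) (g : UnitaryGroup.arch (↥(maximalRealSubfield L)) L (IsCMField.complexConj L) 3 H₂) :
    archExplicitDelta L H γH μ (Φ g) = archExplicitDelta L H₂ γH μ g := by
  by_cases h : IsArchNormPair L H₂ γH g
  · rw [archExplicitDelta_of_isArchNormPair L H γH μ ((isArchNormPair_archCongr_iff L T Φ hΦ γH g).2 h),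
      archExplicitDelta_of_isArchNormPair L H₂ γH μ h]
    have hk : (∏ w : {w : InfinitePlace L // IsComplex w}, archKappaAt L H γH w (Φ g)) =
        ∏ w : {w : InfinitePlace L // IsComplex w}, archKappaAt L H₂ γH w g :=
      Finset.prod_congr rfl fun w _ => archKappaAt_archCongr L T Φ hΦ hT γH h w
    rw [hk]
  · rw [archExplicitDelta_of_not_isArchNormPair L H γH μ (fun h' => h ((isArchNormPair_archCongr_iff L T Φ hΦ γH g).1 h')),
      archExplicitDelta_of_not_isArchNormPair L H₂ γH μ h]

end Congr

/-! ## §5 The tree's term: `h : c(P)ᵀ H P = H₂` -/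

section OfEq

variable (L : Type) [Field L] [NumberField L] [IsCMField L]

open scoped Classical in
/-- **`Δ″_∞` along the tree's congruence isomorphism `Φ_P`** (★ `unitaryGroupOfFormCongrOfEq … (formCongr_map_mixedEmbedding_archFormOf_eq L h)` for `h : c(P)ᵀ H P = H₂`; `hΦ` by ★
`coe_archCongrOfEq_apply`, `hT` by ★ `formCongr_map_mixedEmbedding_archFormOf_eq`): `Δ″_∞^{H}(γ_H, Φ_P g) = Δ″_∞^{H₂}(γ_H, g)`. [cite: Rogawski1990, §14.4 p. 237; §14.6 p. 242] -/
theorem archExplicitDelta_archCongrOfEq {P : GL (Fin 3) L} {H H₂ : Matrix (Fin 3) (Fin 3) L} (h : formCongr (cmConjRingHom L) P H = H₂)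
    (γH : ↥(UnitaryGroup.arch (↥(maximalRealSubfield L)) L (IsCMField.complexConj L) 2
        (Matrix.of fun i j : Fin 2 => if i.val + j.val + 1 = 2 then (1 : L) else 0)) ×
      ↥(UnitaryGroup.arch (↥(maximalRealSubfield L)) L (IsCMField.complexConj L) 1
        (Matrix.of fun i j : Fin 1 => if i.val + j.val + 1 = 1 then (1 : L) else 0)))
    (μ : HeckeCharacter L) (g : UnitaryGroup.arch (↥(maximalRealSubfield L)) L (IsCMField.complexConj L) 3 H₂) :
    archExplicitDelta L H γH μ
        (unitaryGroupOfFormCongrOfEq (UnitaryGroup.conjMixed (↥(maximalRealSubfield L)) L (IsCMField.complexConj L)) (Matrix.GeneralLinearGroup.map (mixedEmbedding L) P)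
          (UnitaryGroup.archFormOf L 3 H) (UnitaryGroup.archFormOf L 3 H₂) (UnitaryGroup.formCongr_map_mixedEmbedding_archFormOf_eq L h) g) =
      archExplicitDelta L H₂ γH μ g :=
  archExplicitDelta_archCongr L (Matrix.GeneralLinearGroup.map (mixedEmbedding L) P) _ (UnitaryGroup.coe_archCongrOfEq_apply L h)
    (UnitaryGroup.formCongr_map_mixedEmbedding_archFormOf_eq L h) γH μ g

end OfEq

end Literature.NumberTheory.Rogawski1990

end
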